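import Summits.BirchSwinnertonDyer.BirchSwinnertonDyer.Theorems.TwoAdicConverseBDPSelmerLowerDivisibilityAtTwoGaussContent
import Summits.BirchSwinnertonDyer.BirchSwinnertonDyer.Theorems.SignedBaseChangeTwistPairGreenbergProductDivisibilitySplitRationalAnchor
import Literature.NumberTheory.EllipticCurves.YanZhu2026.GreenbergMainTheorems
import HarnessLib

/-!
# PINNING AT A PRIME OF THE SPECIAL FIBRE and the `p`-CONTENT of an algebraic generator — the two kernel pieces of the
# resplit node `anticyclotomic-fibre-pinning-two` of O2 `BDPSelmerLowerDivisibilityAtTwo` (stmt-BirchSwinnertonDyer-24728),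
# landed under `Theorems/` so that the line of record can import them (crux idea seat 1 GEN 3's `PrimePinning₂` /
# `TwoContent₂`, proofs ported verbatim for a general prime `p`, statements UNFOLDED)

Helper file `--supports stmt-BirchSwinnertonDyer-24728` (LEAD `cruxlead-stmt-BirchSwinnertonDyer-19556` g11, executing pen RC-563 (B)(1):
«v4.2 := v4.1 with RresEq REPLACED by `AcFibrePinningAtTwo` iff the composition elaborates against v4.1's own frame»).  THEOREMS ONLY
(no definition, no named fact, no instance, no `sorry`); any prime `p`.  AUTHORSHIP: the statements and proofs are those of
`Cruxes/BDPSelmerLowerDivisibilityAtTwo/Lines/anticyclotomic_fibre_pinning_two.lean` §1–§2 (planner-cruxidea-stmt-BirchSwinnertonDyer-24728-1,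
GEN 3; `primePinning₂_holds`, `twoContent₂_holds`), generalised from `2` to `p` and unfolded (`A₂`, `Ω₂`, `red₂ = map (map residue)`)
so that a theorems-only file can carry them; a Cruxes workfile is not importable.

* §1 `map_map_residue_natCast_prime` (`red p = 0`: the special fibre has characteristic `p`), `natCast_prime_pow_ne_zero`.
* §2 ★ `span_le_span_of_prime_pin` — **PIN**: in `A = 𝒪_{ℂ_p}⟦T₁⟧⟦T₂⟧`, if `p^m·G = p^a·C₁·h` with `red C₁ ≠ 0`, and for some PRIME
  `𝔓 ⊂ 𝔽̄_p⟦T₁⟧⟦T₂⟧` one has `red G ∉ 𝔓` (N: `μ = 0` ALONG `𝔓`) and `red C₁ ∈ 𝔓 + (red G)` (Λ: along `𝔓`, `red G` divides `red C₁`),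
  then `(p^a·C₁) ⊆ (G)`.  Proof (seat 1): `a ≤ m` (else `red G = 0 ∈ 𝔓`); Gauss content for constants (tower-1 GEN 44,
  `C_C_dvd_of_C_C_dvd_mul_of_exists_isUnit_coeff`) gives `h = p^{m−a} h₀`, `G = C₁ h₀`; modulo `𝔪`: `Ḡ(1 − q h̄₀) ∈ 𝔓`, so
  `1 − q h̄₀ ∈ 𝔓 ⊆ 𝔪_Ω` and `h̄₀` is a unit of the LOCAL ring `𝔽̄_p⟦T₁⟧⟦T₂⟧`, hence `h₀ ∈ Aˣ`.  `𝔓 = ⊥` is the line of record's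
  residual equality; `𝔓 = (T₁)` is the coordinate-line pin of the lead's `TwoAdicBDPLinePin` (p768050).
* §3 ★ `exists_toUnr₂_eq_natCast_pow_mul_of_ne_zero` — **CONTENT**: every non-zero `C₀ ∈ Λ₂ = ℤ_p⟦T₁⟧⟦T₂⟧` reads along any
  `J : ℤ_p → 𝒪_{ℂ_p}` as `toUnr₂ J C₀ = p^a · C₁` with `C₁` PRIMITIVE (`red C₁ ≠ 0`), `a = μ(C₀)` (discrete valuation on the
  coefficients; false for a general element of `A`).  So positive algebraic `μ` is ALLOWED at the seam.

Nothing about any elliptic curve is asserted; O2, 19556, 19218 stay OPEN; BSD is proved for no curve.  References: [folklore]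
(Gauss's lemma over a rank-one valuation ring; local rings); pen RC-556 / RC-563; seat 1's card
`Cruxes/BDPSelmerLowerDivisibilityAtTwo/Ideas/anticyclotomic-fibre-pinning-two.md`.
-/

-- D-0017: single-problem summit, the namespace repeats the problem name by design.
set_option linter.dupNamespace false
set_option autoImplicit false

noncomputable section

open scoped Classical

namespace Summit.BirchSwinnertonDyer.BirchSwinnertonDyer.Theorems.TwoAdicBDPPrimePinning

open PowerSeries Literature.NumberTheory.EllipticCurves
  Summit.BirchSwinnertonDyer.BirchSwinnertonDyer.Theorems.TwoAdicBDPGaussContent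

variable {p : ℕ} [Fact p.Prime]

/-! ## §1 The special fibre has characteristic `p` -/

/-- `red (p : 𝒪_{ℂ_p}⟦T₁⟧⟦T₂⟧) = 0`: the residue of `p` vanishes (`p` is not a unit of `𝒪_{ℂ_p}`). [folklore] -/
theorem map_map_residue_natCast_prime :
    PowerSeries.map (PowerSeries.map (IsLocalRing.residue (PadicComplexInt p)))
      ((p : ℕ) : PowerSeries (PowerSeries (PadicComplexInt p))) = 0 := by
  have hres : IsLocalRing.residue (PadicComplexInt p) ((p : ℕ) : PadicComplexInt p) = 0 :=
    (IsLocalRing.residue_eq_zero_iff _).mpr ((IsLocalRing.mem_maximalIdeal _).mpr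
      (mem_nonunits_iff.mpr
        (Summit.BirchSwinnertonDyer.BirchSwinnertonDyer.Theorems.SignedBaseChangeK1RationalAnchor.not_isUnit_natCast_padicComplexInt
          (p := p))))
  rw [← map_natCast (PowerSeries.C (R := PowerSeries (PadicComplexInt p))),
    ← map_natCast (PowerSeries.C (R := PadicComplexInt p)), PowerSeries.map_C, PowerSeries.map_C, hres, map_zero, map_zero]

/-- `p^n ≠ 0` in `𝒪_{ℂ_p}⟦T₁⟧⟦T₂⟧`. [folklore] -/
theorem natCast_prime_pow_ne_zero (n : ℕ) :
    ((p : ℕ) : PowerSeries (PowerSeries (PadicComplexInt p))) ^ n ≠ 0 := by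
  rw [natCast_pow_eq_C_C]
  exact C_C_ne_zero (pow_ne_zero n (natCast_prime_padicComplexInt_ne_zero (p := p)))

/-! ## §2 PIN — pinning the cofactor at a prime of the special fibre -/

/-- **PIN (seat 1's `PrimePinning₂`, general prime, unfolded).**  In `A = 𝒪_{ℂ_p}⟦T₁⟧⟦T₂⟧` with
`red = map (map residue) : A → 𝔽̄_p⟦T₁⟧⟦T₂⟧`: if `p^m·G = p^a·C₁·h`, `red C₁ ≠ 0`, and for some prime `𝔓` of `𝔽̄_p⟦T₁⟧⟦T₂⟧`
`red G ∉ 𝔓` and `red C₁ ∈ 𝔓 ⊔ (red G)`, then `(p^a·C₁) ⊆ (G)`. [folklore] -/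
theorem span_le_span_of_prime_pin (C₁ G h : PowerSeries (PowerSeries (PadicComplexInt p))) (a m : ℕ)
    (𝔓 : Ideal (PowerSeries (PowerSeries (IsLocalRing.ResidueField (PadicComplexInt p))))) (h𝔓 : 𝔓.IsPrime)
    (hGCh : ((p : ℕ) : PowerSeries (PowerSeries (PadicComplexInt p))) ^ m * G =
      ((p : ℕ) : PowerSeries (PowerSeries (PadicComplexInt p))) ^ a * C₁ * h)
    (hC₁ : PowerSeries.map (PowerSeries.map (IsLocalRing.residue (PadicComplexInt p))) C₁ ≠ 0)
    (hN : PowerSeries.map (PowerSeries.map (IsLocalRing.residue (PadicComplexInt p))) G ∉ 𝔓)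
    (hΛ : PowerSeries.map (PowerSeries.map (IsLocalRing.residue (PadicComplexInt p))) C₁ ∈
      𝔓 ⊔ Ideal.span {PowerSeries.map (PowerSeries.map (IsLocalRing.residue (PadicComplexInt p))) G}) :
    Ideal.span {((p : ℕ) : PowerSeries (PowerSeries (PadicComplexInt p))) ^ a * C₁} ≤ Ideal.span {G} := by
  set red := PowerSeries.map (PowerSeries.map (IsLocalRing.residue (PadicComplexInt p))) with hred
  set P : PowerSeries (PowerSeries (PadicComplexInt p)) := ((p : ℕ) : PowerSeries (PowerSeries (PadicComplexInt p)))
    with hP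
  have hredP : red P = 0 := map_map_residue_natCast_prime
  rcases Nat.lt_or_ge m a with hma | ham
  · -- `m < a`: then `G = p·(…)`, so `red G = 0 ∈ 𝔓`, contradicting (N)
    obtain ⟨n, rfl⟩ : ∃ n, a = m + (n + 1) := ⟨a - m - 1, by omega⟩
    have h1 : G = P ^ (n + 1) * C₁ * h := by
      refine mul_left_cancel₀ (natCast_prime_pow_ne_zero (p := p) m) ?_
      rw [hGCh, pow_add]; ring
    have h0 : red G = 0 := by
      rw [h1, map_mul, map_mul, map_pow, hredP, zero_pow (Nat.succ_ne_zero n), zero_mul, zero_mul]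
    exact absurd (show red G ∈ 𝔓 by rw [h0]; exact 𝔓.zero_mem) hN
  · -- `a ≤ m`: cancel `p^a`, then Gauss content for the constant `p^(m-a)`
    obtain ⟨n, rfl⟩ := Nat.exists_eq_add_of_le ham
    have h1 : P ^ n * G = C₁ * h := by
      refine mul_left_cancel₀ (natCast_prime_pow_ne_zero (p := p) a) ?_
      rw [← mul_assoc, ← pow_add, hGCh, mul_assoc]
    have hC₁u : ∃ i : ℕ × ℕ, IsUnit (coeff i.2 (coeff i.1 C₁)) :=
      exists_isUnit_coeff_of_map_map_residue_ne_zero hC₁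
    have hdvd : PowerSeries.C (PowerSeries.C (((p : ℕ) : PadicComplexInt p) ^ n)) ∣ C₁ * h :=
      ⟨G, by rw [← h1, hP, natCast_pow_eq_C_C]⟩
    obtain ⟨h₀, rfl⟩ := C_C_dvd_of_C_C_dvd_mul_of_exists_isUnit_coeff hC₁u hdvd
    have hG : G = C₁ * h₀ := by
      refine mul_left_cancel₀ (natCast_prime_pow_ne_zero (p := p) n) ?_
      rw [← hP, h1, hP, natCast_pow_eq_C_C]; ring
    -- residual bookkeeping in the LOCAL ring `𝔽̄_p⟦T₁⟧⟦T₂⟧`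
    obtain ⟨t, ht, s, hs, hts⟩ := Submodule.mem_sup.mp hΛ
    obtain ⟨q, rfl⟩ := Ideal.mem_span_singleton'.mp hs
    have hGred : red G = red C₁ * red h₀ := by rw [hG, map_mul]
    have hkey : red G * (1 - q * red h₀) = t * red h₀ := by
      have e : red G = (t + q * red G) * red h₀ := by rw [hts]; exact hGred
      linear_combination e
    have hmem : red G * (1 - q * red h₀) ∈ 𝔓 := by
      rw [hkey]; exact 𝔓.mul_mem_right _ ht
    rcases h𝔓.mem_or_mem hmem with h0 | h0
    · exact absurd h0 hN
    · have hmax : 1 - q * red h₀ ∈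
          IsLocalRing.maximalIdeal (PowerSeries (PowerSeries (IsLocalRing.ResidueField (PadicComplexInt p)))) :=
        IsLocalRing.le_maximalIdeal h𝔓.ne_top h0
      have hunit : IsUnit (q * red h₀) := by
        rcases IsLocalRing.isUnit_or_isUnit_one_sub_self (q * red h₀) with hu | hu
        · exact hu
        · exact absurd hu (mem_nonunits_iff.mp ((IsLocalRing.mem_maximalIdeal _).mp hmax))
      obtain ⟨u, hu⟩ := isUnit_of_isUnit_map_map_residue (isUnit_of_mul_isUnit_right hunit)
      refine Ideal.span_singleton_le_span_singleton.mpr ⟨↑u⁻¹ * P ^ a, ?_⟩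
      rw [hG, ← hu, mul_assoc, Units.mul_inv_cancel_left, mul_comm]

/-- `p = 2` literal form of PIN (the slack `2^m`, the content `2^a`, as in the line files' `A₂`). [folklore] -/
theorem span_le_span_of_prime_pin_two (C₁ G h : PowerSeries (PowerSeries (PadicComplexInt 2))) (a m : ℕ)
    (𝔓 : Ideal (PowerSeries (PowerSeries (IsLocalRing.ResidueField (PadicComplexInt 2))))) (h𝔓 : 𝔓.IsPrime)
    (hGCh : (2 : PowerSeries (PowerSeries (PadicComplexInt 2))) ^ m * G =
      (2 : PowerSeries (PowerSeries (PadicComplexInt 2))) ^ a * C₁ * h)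
    (hC₁ : PowerSeries.map (PowerSeries.map (IsLocalRing.residue (PadicComplexInt 2))) C₁ ≠ 0)
    (hN : PowerSeries.map (PowerSeries.map (IsLocalRing.residue (PadicComplexInt 2))) G ∉ 𝔓)
    (hΛ : PowerSeries.map (PowerSeries.map (IsLocalRing.residue (PadicComplexInt 2))) C₁ ∈
      𝔓 ⊔ Ideal.span {PowerSeries.map (PowerSeries.map (IsLocalRing.residue (PadicComplexInt 2))) G}) :
    Ideal.span {(2 : PowerSeries (PowerSeries (PadicComplexInt 2))) ^ a * C₁} ≤ Ideal.span {G} := by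
  have h := span_le_span_of_prime_pin (p := 2) C₁ G h a m 𝔓 h𝔓 (by rw [Nat.cast_ofNat]; exact hGCh) hC₁ hN hΛ
  rwa [Nat.cast_ofNat] at h

/-! ## §3 CONTENT — the `p`-content of a non-zero element of `Λ₂ = ℤ_p⟦T₁⟧⟦T₂⟧` -/

/-- **CONTENT (seat 1's `TwoContent₂`, general prime, unfolded).**  Every non-zero `C₀ ∈ ℤ_p⟦T₁⟧⟦T₂⟧` reads, along any ring map
`J : ℤ_p → 𝒪_{ℂ_p}`, as `toUnr₂ J C₀ = p^a · C₁` with `red C₁ ≠ 0` (`a` = the least `n` with a coefficient not divisible by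
`p^{n+1}`, i.e. `μ(C₀)`). [folklore] -/
theorem exists_toUnr₂_eq_natCast_pow_mul_of_ne_zero (J : ℤ_[p] →+* PadicComplexInt p) (C₀ : IwasawaAlgebra₂ p)
    (hC₀ : C₀ ≠ 0) :
    ∃ (a : ℕ) (C₁ : PowerSeries (PowerSeries (PadicComplexInt p))),
      IwasawaAlgebra₂.toUnr₂ p J C₀ = ((p : ℕ) : PowerSeries (PowerSeries (PadicComplexInt p))) ^ a * C₁ ∧
        PowerSeries.map (PowerSeries.map (IsLocalRing.residue (PadicComplexInt p))) C₁ ≠ 0 := by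
  -- a nonzero coefficient and its exact `p`-power
  have hcoef : ∃ ij : ℕ × ℕ, coeff ij.2 (coeff ij.1 C₀) ≠ 0 := by
    by_contra hall
    push Not at hall
    exact hC₀ (PowerSeries.ext fun i => PowerSeries.ext fun j => by simpa using hall (i, j))
  obtain ⟨ij₀, hij₀⟩ := hcoef
  have hirr : Irreducible ((p : ℕ) : ℤ_[p]) := PadicInt.irreducible_p
  obtain ⟨n₀, c, hc, hn₀⟩ := WfDvdMonoid.max_power_factor hij₀ hirr
  have hex : ∃ n : ℕ, ∃ ij : ℕ × ℕ, ¬ (((p : ℕ) : ℤ_[p]) ^ (n + 1) ∣ coeff ij.2 (coeff ij.1 C₀)) := by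
    refine ⟨n₀, ij₀, fun hd => hc ?_⟩
    rw [hn₀, pow_succ] at hd
    exact (mul_dvd_mul_iff_left (pow_ne_zero n₀ hirr.ne_zero)).mp hd
  -- `a` := the least `n` such that some coefficient is not divisible by `p^(n+1)` (= `μ(C₀)`)
  obtain ⟨a, ha_spec, ha_min⟩ : ∃ a : ℕ, (∃ ij : ℕ × ℕ, ¬ (((p : ℕ) : ℤ_[p]) ^ (a + 1) ∣ coeff ij.2 (coeff ij.1 C₀))) ∧
      ∀ n < a, ∀ ij : ℕ × ℕ, ((p : ℕ) : ℤ_[p]) ^ (n + 1) ∣ coeff ij.2 (coeff ij.1 C₀) := by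
    refine ⟨Nat.find hex, Nat.find_spec hex, fun n hn ij => ?_⟩
    have hmin := Nat.find_min hex hn
    push Not at hmin
    exact hmin ij
  have hdiv : ∀ ij : ℕ × ℕ, ∃ d : ℤ_[p], coeff ij.2 (coeff ij.1 C₀) = ((p : ℕ) : ℤ_[p]) ^ a * d := by
    intro ij
    rcases Nat.eq_zero_or_pos a with ha | ha
    · exact ⟨coeff ij.2 (coeff ij.1 C₀), by rw [ha, pow_zero, one_mul]⟩
    · obtain ⟨n, rfl⟩ : ∃ n, a = n + 1 := ⟨a - 1, by omega⟩
      exact ha_min n (Nat.lt_succ_self n) ij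
  choose d hd using hdiv
  refine ⟨a, PowerSeries.mk fun i => PowerSeries.mk fun j => J (d (i, j)), ?_, ?_⟩
  · -- `J(C₀) = p^a · C₁` coefficientwise
    refine PowerSeries.ext fun i => PowerSeries.ext fun j => ?_
    rw [IwasawaAlgebra₂.coeff_coeff_toUnr₂, hd (i, j), map_mul, map_pow, map_natCast, natCast_pow_eq_C_C,
      PowerSeries.coeff_C_mul, PowerSeries.coeff_C_mul, PowerSeries.coeff_mk, PowerSeries.coeff_mk]
  · -- `C₁` is primitive: at the index realising `a`, `d` is a `p`-adic unit
    obtain ⟨ij₁, hij₁⟩ := ha_spec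
    have hd₁ : ¬ (((p : ℕ) : ℤ_[p]) ∣ d ij₁) := by
      intro hpd
      apply hij₁
      rw [hd ij₁, pow_succ]
      exact mul_dvd_mul_left _ hpd
    have hunit : IsUnit (d ij₁) := by
      by_contra hnu
      apply hd₁
      have hmem : d ij₁ ∈ IsLocalRing.maximalIdeal ℤ_[p] :=
        (IsLocalRing.mem_maximalIdeal _).mpr (mem_nonunits_iff.mpr hnu)
      rwa [PadicInt.maximalIdeal_eq_span_p, Ideal.mem_span_singleton] at hmem
    intro h0
    have hc := congrArg (fun F : PowerSeries (PowerSeries (IsLocalRing.ResidueField (PadicComplexInt p))) =>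
      coeff ij₁.2 (coeff ij₁.1 F)) h0
    simp only [PowerSeries.coeff_map, PowerSeries.coeff_mk, map_zero, Prod.mk.eta] at hc
    exact (IsLocalRing.residue_ne_zero_iff_isUnit _).mpr (hunit.map J) hc

/-- `p = 2` literal form of CONTENT. [folklore] -/
theorem exists_toUnr₂_eq_two_pow_mul_of_ne_zero (J : ℤ_[2] →+* PadicComplexInt 2) (C₀ : IwasawaAlgebra₂ 2)
    (hC₀ : C₀ ≠ 0) :
    ∃ (a : ℕ) (C₁ : PowerSeries (PowerSeries (PadicComplexInt 2))),
      IwasawaAlgebra₂.toUnr₂ 2 J C₀ = (2 : PowerSeries (PowerSeries (PadicComplexInt 2))) ^ a * C₁ ∧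
        PowerSeries.map (PowerSeries.map (IsLocalRing.residue (PadicComplexInt 2))) C₁ ≠ 0 := by
  obtain ⟨a, C₁, h1, h2⟩ := exists_toUnr₂_eq_natCast_pow_mul_of_ne_zero (p := 2) J C₀ hC₀
  exact ⟨a, C₁, by rwa [Nat.cast_ofNat] at h1, h2⟩

end Summit.BirchSwinnertonDyer.BirchSwinnertonDyer.Theorems.TwoAdicBDPPrimePinning

end
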